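import Literature.Probability.RandomPlanarGeometry.SLEBubblesCloud
import HarnessLib

/-!
# [LSW] p. 5 result 2 from §7–§8: the assembly after the proved reductions

Third companion of `Literature.Probability.RandomPlanarGeometry.SLEBubbles` ([LSW] §7.2), after

* G. F. Lawler, O. Schramm, W. Werner, *Conformal restriction: the chordal case*, J. Amer. Math.
  Soc. **16** (2003) 917–955, arXiv:math/0209343 (**[LSW]**), §7.1 (pp. 27–28: the Brownian
  bubble measure `μ`, "the measure on Brownian bubbles at `0` as the image of `ν` under the
  inversion", `ν` being the limit (7.1) of the laws of FILLED Brownian excursions), §7.2 and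
  Thm. 7.3 (pp. 28–29), Thm. 8.4 and Cor. 8.6 (p. 37).

The assembly `IsRestrictionMeasure.eq_five_eighths_of_simple_of_bubbles` of `SLEBubbles` takes
eight named facts. Two of them have since been reduced to more basic ones —
`SLEBubbles.exists_cloud` to Kingman's existence theorem
(`SLEBubbles.exists_cloud_of_exists_isPoissonCloud`, file `SLEBubblesCloud`) and
`SLEBubbles.ae_interior_nonempty` to the interior property of the bubbles
(`SLEBubbles.ae_interior_nonempty_of_ae_interior_nonempty`, file `SLEBubblesProofs`, the
infiniteness of `μ` being proved) — and this file records the resulting assembly, with one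
further sharpening:

* `Literature.Probability.RandomPlanarGeometry.exists_isBrownianBubbleMeasure_ae_interior_nonempty`
  — NAMED FACT ([LSW] §7.1 with folklore): THERE IS a Brownian bubble measure (a measure on
  `Ω_b` with the hitting masses (7.2)) almost every bubble of which has an interior point —
  namely [LSW]'s `μ`, carried by fillings of Brownian loops rooted at `0`. This is the
  conjunction, for that one measure, of the two facts `exists_isBrownianBubbleMeasure` and
  `IsBrownianBubbleMeasure.ae_interior_nonempty` of `BrownianBubbles`
  (`exists_isBrownianBubbleMeasure_ae_interior_nonempty_of_facts`), and it is all the assembly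
  needs: by uniqueness of `P_α` (Prop. 3.3) ONE construction of `P_α` with interior points
  suffices. Unlike the second of those facts (stated for EVERY measure with the hitting masses
  (7.2)), it does not presuppose that (7.2) determines `μ` — a uniqueness statement which
  [LSW] never needs (they construct `μ`) and which is not proved in the tree (the hitting
  events of `*`-hulls are not a π-system: two `*`-hulls may enclose `0` between them).
* `Literature.Probability.RandomPlanarGeometry.SLEBubbles.ae_interior_nonempty_of_measure` —
  PROVED: for `0 < κ < 8/3` and a Brownian bubble measure `μ` almost every bubble of which has
  an interior point, almost surely `Ξ(κ)` has an interior point (the argument of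
  `SLEBubbles.ae_interior_nonempty_of_facts` for this one `μ`, with
  `IsBrownianBubbleMeasure.measure_univ_eq_top_holds`).
* PROVED assemblies with the hypotheses (all named facts of the tree):
  `exists_isBrownianBubbleMeasure_ae_interior_nonempty` (§7.1), Kingman's
  `Literature.Probability.Process.exists_isPoissonCloud` (§7.2's cloud),
  `SLEBubbles.exists_measurable_version` and `SLEBubbles.measure_disjoint` (Thm. 7.3), and for
  p. 5 result 2 also `SLEKappaRho.exists_measurable_fill_version`,
  `SLEKappaRho.measure_fill_disjoint` (Thm. 8.4), `SLEKappaRho.one_half_lt_measure_I_notMem_fill`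
  (proof of Cor. 8.6): `exists_isRestrictionMeasure_interior_of_gt_five_eighths'`,
  `IsRestrictionMeasure.ae_interior_nonempty_of_gt_five_eighths_of_bubbles'`,
  `exists_isRestrictionMeasure_ae_interior_nonempty_of_bubbles'`,
  `IsRestrictionMeasure.eq_five_eighths_of_simple_of_bubbles'`,
  `IsRestrictionMeasure.eq_five_eighths_of_outer_simple_of_bubbles'`.
-/

noncomputable section

open Set Filter Topology MeasureTheory
open UpperHalfPlane (upperHalfPlaneSet)
open scoped NNReal ENNReal
open Literature.Probability.Process (preWienerMeasure IsPoissonCloud exists_isPoissonCloud)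

namespace Literature.Probability.RandomPlanarGeometry

/-! ### The Brownian bubble measure with interior points ([LSW] §7.1) -/

/-- NAMED FACT — **there is a Brownian bubble measure whose bubbles have interior points**
([LSW] §7.1, pp. 27–28, with folklore): some measure `μ` on `Ω_b` with the hitting masses
(7.2), `μ[K ∩ A ≠ ∅] = −SΦ_A(0)/6` for `A ∈ 𝒬*` (`IsBrownianBubbleMeasure`), gives full measure
to the bubbles with an interior point — [LSW]'s `μ`, "the measure on Brownian bubbles at `0`",
the image under `z ↦ −1/z` of the limit `ν` (7.1) of the laws `P̂^{x+iy}` of FILLED Brownian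
excursions (p. 27: "let `P̂^z` denote [the] law of the filling of `Z`"), satisfies (7.2) by
Lemma 4.3 and (5.1), and a
planar Brownian path run for positive time almost surely disconnects a nonempty open set from
`∞`, so that its filling has interior points (folklore; this is why the samples of `P_α`,
`α > 5/8`, are not simple curves, p. 29: "The frontier of the set defined under `P_α` has
Hausdorff dimension `4/3` (because of the Brownian bubbles)"). The conjunction, for this one
measure, of `exists_isBrownianBubbleMeasure` and `IsBrownianBubbleMeasure.ae_interior_nonempty`
(`exists_isBrownianBubbleMeasure_ae_interior_nonempty_of_facts`); unlike the latter it does not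
presuppose that (7.2) determines `μ`. [cite: LawlerSchrammWerner2003Restriction, §7.1 eqs. (7.1)–(7.2) (pp. 27–28)] -/
def exists_isBrownianBubbleMeasure_ae_interior_nonempty : Prop :=
  ∃ μ : Measure BubbleConfig, IsBrownianBubbleMeasure μ ∧
    ∀ᵐ K : BubbleConfig ∂μ, (interior (K : Set ℂ)).Nonempty

/-- The existential fact from the two facts of `BrownianBubbles` (existence of a Brownian
bubble measure; interior points for every such measure). [folklore] -/
theorem exists_isBrownianBubbleMeasure_ae_interior_nonempty_of_facts
    (h₁ : exists_isBrownianBubbleMeasure) (h₂ : IsBrownianBubbleMeasure.ae_interior_nonempty) :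
    exists_isBrownianBubbleMeasure_ae_interior_nonempty := by
  obtain ⟨μ, hμ⟩ := h₁
  exact ⟨μ, hμ, h₂ hμ⟩

/-! ### `Ξ(κ)` has interior points, for one bubble measure -/

/-- **`Ξ(κ)` has interior points** for `0 < κ < 8/3`, a Brownian bubble measure `μ` almost every
bubble of which has an interior point, and an independent Poisson cloud with mean `λ_κ μ ⊗ dt`
(the argument of `SLEBubbles.ae_interior_nonempty_of_facts` for this `μ`: the cloud is a.s.
nonempty because its mean measure is infinite, `IsBrownianBubbleMeasure.measure_univ_eq_top_holds`;
a.s. none of its bubbles lies in the null set of bubbles without interior points; attached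
bubbles `g_t⁻¹(K + W_t)` keep interior points, `interior_attachedBubble_nonempty`).
[cite: LawlerSchrammWerner2003Restriction, §7.2 (p. 28) with §7.1 (p. 27)] -/
theorem SLEBubbles.ae_interior_nonempty_of_measure {κ : ℝ≥0} (hκ0 : 0 < κ) (hκ : κ < 8 / 3)
    {μ : Measure BubbleConfig} (hμ : IsBrownianBubbleMeasure μ)
    (hμint : ∀ᵐ K : BubbleConfig ∂μ, (interior (K : Set ℂ)).Nonempty)
    {Ω' : Type} [MeasurableSpace Ω'] {P' : Measure Ω'} {X : Ω' → Set (BubbleConfig × ℝ≥0)}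
    (hX : IsPoissonCloud (bubbleCloudIntensity κ μ) X P') :
    ∀ᵐ p ∂(preWienerMeasure.prod P'), (interior (sleBubbleSet κ p.1 (X p.2))).Nonempty := by
  haveI : IsProbabilityMeasure P' := hX.isProbabilityMeasure
  haveI : IsProbabilityMeasure preWienerMeasure := isProbabilityMeasure_preWienerMeasure'
  -- the bubbles without interior points lie in a null measurable set `N`
  obtain ⟨N, hNsub, hNmeas, hN0⟩ :=
    exists_measurable_superset_of_null (s := {K : BubbleConfig | ¬ (interior (K : Set ℂ)).Nonempty})
      (ae_iff.1 hμint)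
  set s : Set (BubbleConfig × ℝ≥0) := N ×ˢ univ with hs
  have hsmeas : MeasurableSet s := hNmeas.prod MeasurableSet.univ
  have hΛs : bubbleCloudIntensity κ μ s = 0 := bubbleCloudIntensity_prod_univ_eq_zero κ hN0
  -- a.s. no point of the cloud lies in `s`
  have havoid : ∀ᵐ ω' ∂P', X ω' ∩ s = ∅ := by
    have hmeas : MeasurableSet {ω' | X ω' ∩ s = ∅} := hX.measurableSet_inter_eq_empty hsmeas
    have hone : P' {ω' | X ω' ∩ s = ∅} = 1 := by
      rw [hX.measure_inter_eq_empty hsmeas (by rw [hΛs]; exact ENNReal.zero_ne_top), hΛs]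
      simp
    rw [ae_iff]
    exact (prob_compl_eq_zero_iff hmeas).2 hone
  -- a.s. the cloud is nonempty: its mean measure is infinite (`μ(Ω_b) = ∞`, proved)
  have hne : ∀ᵐ ω' ∂P', (X ω').Nonempty :=
    hX.ae_nonempty_of_measure_univ (bubbleCloudIntensity_univ (sleBubbleIntensity_ne_zero hκ0 hκ)
      (by rw [IsBrownianBubbleMeasure.measure_univ_eq_top_holds hμ]; exact ENNReal.top_ne_zero))
  -- lift to the product space
  have hprod : ∀ᵐ p ∂(preWienerMeasure.prod P'), (X p.2).Nonempty ∧ X p.2 ∩ s = ∅ :=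
    (Measure.quasiMeasurePreserving_snd (μ := preWienerMeasure) (ν := P')).ae (hne.and havoid)
  filter_upwards [hprod] with p hp
  obtain ⟨⟨q, hq⟩, hXs⟩ := hp
  -- the bubble `q.1` has an interior point
  have hqN : q.1 ∉ N := fun h ↦ by
    have : q ∈ X p.2 ∩ s := ⟨hq, ⟨h, mem_univ _⟩⟩
    rw [hXs] at this
    exact this
  have hint : (interior ((q.1 : BubbleConfig) : Set ℂ)).Nonempty := by
    by_contra h
    exact hqN (hNsub h)
  -- hence so does its attached bubble, a subset of `Ξ`
  obtain ⟨z, hz⟩ := interior_attachedBubble_nonempty κ p.1 q.1.subset_upperHalfPlaneSet hint q.2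
  refine ⟨z, interior_mono ?_ hz⟩
  intro w hw
  refine attachedBubble_inter_subset_sleBubbleSet κ p.1 hq ⟨hw, ?_⟩
  exact le_of_lt (show 0 < w.im from
    attachedBubble_subset_upperHalfPlaneSet κ p.1 q.1.subset_upperHalfPlaneSet q.2 hw)

/-! ### The assembly -/

/-- **Existence of `P_α` with interior points for `α > 5/8`** ([LSW] p. 29: "for all `α > 5/8`,
the measure `P_α` exists and can be constructed by adding bubbles with appropriate intensity to
SLE_κ with `κ = 6/(2α + 1)`"), from: a Brownian bubble measure with interior points (§7.1),
Kingman's existence theorem (the cloud of §7.2, `SLEBubbles.exists_cloud_of_exists_isPoissonCloud`)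
and Theorem 7.3 (version `h₁`, avoidance formula `h₂`).
[cite: LawlerSchrammWerner2003Restriction, Thm. 7.3 and p. 29] -/
theorem exists_isRestrictionMeasure_interior_of_gt_five_eighths'
    (hμex : exists_isBrownianBubbleMeasure_ae_interior_nonempty) (hK : exists_isPoissonCloud.{0})
    (h₁ : SLEBubbles.exists_measurable_version) (h₂ : SLEBubbles.measure_disjoint)
    {α : ℝ} (hα : 5 / 8 < α) :
    ∃ P : Measure RestrictionConfig, IsRestrictionMeasure α P ∧
      ∀ᵐ K : RestrictionConfig ∂P, (interior (K : Set ℂ)).Nonempty := by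
  obtain ⟨μ, hμ, hμint⟩ := hμex
  have hα0 : 0 ≤ α := by linarith
  set κ := sleKappaOfExponent α with hκdef
  have hκ0 : 0 < κ := sleKappaOfExponent_pos hα0
  have hκlt : κ < 8 / 3 := sleKappaOfExponent_lt hα
  obtain ⟨Ω', _, P', X, hX⟩ := SLEBubbles.exists_cloud_of_exists_isPoissonCloud hK hμ κ
  obtain ⟨Kc, hKc, hae, hP⟩ := SLEBubbles.isRestrictionMeasure_map h₁ h₂ hκ0 hκlt.le hμ hX
  rw [hκdef, sleBubbleExponent_sleKappaOfExponent hα0] at hP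
  refine ⟨_, hP, RestrictionConfig.ae_map_interior_nonempty hKc ?_⟩
  filter_upwards [hae, SLEBubbles.ae_interior_nonempty_of_measure hκ0 hκlt hμ hμint hX] with p hp hi
  show (interior ((Kc p : RestrictionConfig) : Set ℂ)).Nonempty
  rwa [hp]

/-- **The `α > 5/8` leaf** `IsRestrictionMeasure.ae_interior_nonempty_of_gt_five_eighths`
(`RestrictionMeasuresFiveEighths`) from the same four facts, by uniqueness of `P_α`
(`IsRestrictionMeasure.ae_of_exists`). [cite: LawlerSchrammWerner2003Restriction, Thm. 7.3 (pp. 28–29) with Prop. 3.3] -/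
theorem IsRestrictionMeasure.ae_interior_nonempty_of_gt_five_eighths_of_bubbles'
    (hμex : exists_isBrownianBubbleMeasure_ae_interior_nonempty) (hK : exists_isPoissonCloud.{0})
    (h₁ : SLEBubbles.exists_measurable_version) (h₂ : SLEBubbles.measure_disjoint) :
    IsRestrictionMeasure.ae_interior_nonempty_of_gt_five_eighths :=
  fun hP hα ↦ IsRestrictionMeasure.ae_of_exists
    (exists_isRestrictionMeasure_interior_of_gt_five_eighths' hμex hK h₁ h₂ hα) hP

/-- **The existential leaf** `exists_isRestrictionMeasure_ae_interior_nonempty`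
(`RestrictionMeasuresBubbles`) from the same four facts. [cite: LawlerSchrammWerner2003Restriction, Thm. 7.3 and p. 29] -/
theorem exists_isRestrictionMeasure_ae_interior_nonempty_of_bubbles'
    (hμex : exists_isBrownianBubbleMeasure_ae_interior_nonempty) (hK : exists_isPoissonCloud.{0})
    (h₁ : SLEBubbles.exists_measurable_version) (h₂ : SLEBubbles.measure_disjoint) :
    exists_isRestrictionMeasure_ae_interior_nonempty :=
  fun _ hα ↦ exists_isRestrictionMeasure_interior_of_gt_five_eighths' hμex hK h₁ h₂ hα

/-- **[LSW] p. 5 result 2, first sentence (`∀ᵐ` reading)** — the named fact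
`IsRestrictionMeasure.eq_five_eighths_of_simple` — from seven named facts: §7.1's bubble
measure with interior points (`hμex`), Kingman's existence theorem (`hK`), Thm. 7.3 (`h₁`,
`h₂`), and from §8 the `Ω₊`-valued version of `F^{ℝ₊}_ℍ(cl K_∞)` for SLE(8/3, ρ) (`g₁`),
Thm. 8.4's avoidance formula (`g₂`) and the asymmetry of SLE(8/3, ρ), `ρ < 0` (`g₃`, proof of
Cor. 8.6). [cite: LawlerSchrammWerner2003Restriction, p. 5 result 2; Thm. 7.3, Thm. 8.4, Cor. 8.6] -/
theorem IsRestrictionMeasure.eq_five_eighths_of_simple_of_bubbles'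
    (hμex : exists_isBrownianBubbleMeasure_ae_interior_nonempty) (hK : exists_isPoissonCloud.{0})
    (h₁ : SLEBubbles.exists_measurable_version) (h₂ : SLEBubbles.measure_disjoint)
    (g₁ : SLEKappaRho.exists_measurable_fill_version) (g₂ : SLEKappaRho.measure_fill_disjoint)
    (g₃ : SLEKappaRho.one_half_lt_measure_I_notMem_fill) :
    IsRestrictionMeasure.eq_five_eighths_of_simple :=
  IsRestrictionMeasure.eq_five_eighths_of_simple_of_sleKappaRho
    (SLEKappaRho.isRightRestrictionMeasure_fill_of g₁ g₂) g₃
    (IsRestrictionMeasure.ae_interior_nonempty_of_gt_five_eighths_of_bubbles' hμex hK h₁ h₂)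

/-- The outer-measure reading `IsRestrictionMeasure.eq_five_eighths_of_outer_simple` likewise.
[cite: LawlerSchrammWerner2003Restriction, p. 5 result 2; Thm. 7.3, Thm. 8.4, Cor. 8.6] -/
theorem IsRestrictionMeasure.eq_five_eighths_of_outer_simple_of_bubbles'
    (hμex : exists_isBrownianBubbleMeasure_ae_interior_nonempty) (hK : exists_isPoissonCloud.{0})
    (h₁ : SLEBubbles.exists_measurable_version) (h₂ : SLEBubbles.measure_disjoint)
    (g₁ : SLEKappaRho.exists_measurable_fill_version) (g₂ : SLEKappaRho.measure_fill_disjoint)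
    (g₃ : SLEKappaRho.one_half_lt_measure_I_notMem_fill) :
    IsRestrictionMeasure.eq_five_eighths_of_outer_simple :=
  IsRestrictionMeasure.eq_five_eighths_of_outer_simple_of_sleKappaRho
    (SLEKappaRho.isRightRestrictionMeasure_fill_of g₁ g₂) g₃
    (IsRestrictionMeasure.ae_interior_nonempty_of_gt_five_eighths_of_bubbles' hμex hK h₁ h₂)

end Literature.Probability.RandomPlanarGeometry

end
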